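import Summits.HodgeConjecture.HodgeConjecture.Theorems.NikulinTwinTransportSquareGlue
import Summits.HodgeConjecture.HodgeConjecture.Theorems.NikulinTwinTransportSquareTypeTwoTwo
import Literature.AlgebraicGeometry.HodgeTheory.HodgeIndexSurface
import Literature.AlgebraicGeometry.HodgeTheory.LefschetzOneOne
import Literature.NumberTheory.Transcendental.DeRhamTheoremMultiplicative

/-!
# Route AnchorTransport — `AnchorExistence` (stmt-HodgeConjecture-1077), line `Sketch`:
# the `K = ℚ` floor on K3 squares

Stub `anchorExistence_k3Square_floor_of_ratEnd` of the lead skeleton of line `Sketch`: for a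
projective K3 surface `S` whose rational Hodge endomorphisms killing `NS` and valued in `T = NS^⊥`
act on `T` by RATIONAL SCALARS (`End_Hdg(T(S)_ℚ) = ℚ`), every rational `(2,2)`-class on `S ⊗ S` is
algebraic — the Künneth bookkeeping "proving the Hodge conjecture for `X²` is equivalent to showing
that every element of `End_Hdg(T(X))` is algebraic" (Varesco 2023, p. 8) in the case
`End_Hdg(T) = ℚ·id_T`: the Hodge classes of `H⁴(S × S)` are `[S × pt]`, `[pt × S]`, `NS ⊗ NS` and,
in `T ⊗ T ≅ End(T)`, the multiples of `id_T = [Δ] −` (divisor and Künneth-end parts), all algebraic.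

PROOF. The tree already proves the `(2,2)`-heart of this bookkeeping for the sector
`End_Hdg(T) ⊆ ℚ + ℚe` of route NikulinTwinTransport with the splitting `H² = NS ⊕ T` taken from the
Hodge index theorem: `NikulinTwinTransport.mem_algebraicClasses_of_typeTwoTwo`
(`…SquareTypeTwoTwo`, with `…SquareTranscendental.exists_nsProjection`). Its hypotheses on `e` are
only `e|_{NS} = 0`, the uniqueness clause "`f = a + b e` on `T`" and "`e` is induced by an algebraic
class"; they hold for `e := 0` (with the class `γ := 0`) as soon as `End_Hdg(T) = ℚ`, which is the
displayed hypothesis of the stub. The remaining inputs are supplied by the tree: the Künneth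
spanning property (`Hatcher2002_crossProducts_span_complexBetti_holds`), de Rham's theorem in
multiplicative form (`exists_deRhamIsoFamily_holds`, giving `CupPreservesHodgeType` on `S` and
`S ⊗ S` through `cupPreservesHodgeType_of_exists_deRhamIsoFamily` and
`hodgePQ_independent_of_hodgeModel_holds`), the orientation family of `ComplexPoints.isOrientableOver`,
and the named facts given as hypotheses: Lefschetz `(1,1)` (`hL`), markings (`hmark`),
`N¹H² ⊆ H^{1,1}` (`hG`), `b₁ = 0` (`hodd`) and the Hodge index theorem (`hHI`).
-/

noncomputable section

set_option linter.dupNamespace false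

open scoped Manifold
open Module CategoryTheory MonoidalCategory CartesianMonoidalCategory
open Literature.AlgebraicGeometry.Motives Literature.AlgebraicGeometry.HodgeTheory
open Literature.AlgebraicGeometry.Surfaces Literature.Geometry.Kaehler
open Literature.AlgebraicTopology.SingularHomology

namespace Summit.HodgeConjecture.HodgeConjecture.Theorems

open Summit.HodgeConjecture.HodgeConjecture.Theorems.NikulinTwinTransport

/-- **K3-square floor, `K = ℚ`**: for a projective K3 surface `S` whose rational Hodge
endomorphisms killing `NS` and valued in `T = NS^⊥` act on `T` by RATIONAL SCALARS
(`End_Hdg(T(S)_ℚ) = ℚ`), every rational `(2,2)`-class on `S ⊗ S` is algebraic — the Künneth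
bookkeeping "HC for `S²` ⟺ `End_Hdg(T(S))` algebraic" (Varesco 2023 p. 8) with `End_Hdg(T) = ℚ·id_T`,
`id_T = [Δ] −` (divisor and Künneth-end parts); granted Lefschetz `(1,1)`, K3 markings, `NᵖHⁱ ⊆ Fᵖ`,
odd Betti vanishing and Hodge index. Proof: `NikulinTwinTransport.mem_algebraicClasses_of_typeTwoTwo`
(the `(2,2)`-heart of the sector `End_Hdg(T) ⊆ ℚ + ℚe`, whose splitting `H² = NS ⊕ T` comes from the
Hodge index theorem) at `e := 0`, `γ := 0`; Künneth spanning, de Rham and the independence of Hodge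
types from the model are the tree's theorems. [cite: Varesco2023, §2 (p. 8)]
[cite: VoisinHodgeI2002, §11.3.3 Lemma 11.41] -/
theorem anchorExistence_k3Square_floor_of_ratEnd (hL : lefschetzOneOne_rational)
    (hmark : Huybrechts_K3_marking_exists) (hG : Grothendieck1969_supportedClasses_le_hodgeConiveau)
    (hodd : Huybrechts_K3_oddBetti_vanish) (hHI : ∀ S : SchemeOver ℂ, hodgeIndex_surface S) :
    ∀ S : SchemeOver ℂ, IsK3Surface S →
      (∀ f : complexBetti S (2 * 1) →ₗ[ℂ] complexBetti S (2 * 1),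
        (∀ x, IsRationalClass x → IsRationalClass (f x)) →
        (∀ (i j : ℕ) x, IsOfHodgeType 2 S (2 * 1) i j x → IsOfHodgeType 2 S (2 * 1) i j (f x)) →
        (∀ d ∈ algebraicClasses S 1, f d = 0) →
        (∀ x : complexBetti S (2 * 1), ∀ d ∈ algebraicClasses S 1,
          cupProduct (rfl : 2 * 1 + 2 * 1 = 2 * 2) (f x) d = 0) →
        ∃ a : ℚ, ∀ x : complexBetti S (2 * 1),
          (∀ d ∈ algebraicClasses S 1, cupProduct (rfl : 2 * 1 + 2 * 1 = 2 * 2) x d = 0) →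
          f x = (a : ℂ) • x) →
      ∀ c : complexBetti (S ⊗ S) (2 * 2), IsRationalClass c → IsOfHodgeType 4 (S ⊗ S) (2 * 2) 2 2 c →
        c ∈ algebraicClasses (S ⊗ S) 2 := by
  intro S hS hU c hc hct
  have hI : hodgePQ_independent_of_hodgeModel := hodgePQ_independent_of_hodgeModel_holds
  have hdR : ∀ (E : Type) [NormedAddCommGroup E] [NormedSpace ℂ E] [FiniteDimensional ℂ E],
      Literature.NumberTheory.Transcendental.exists_deRhamIsoFamily 𝓘(ℝ, E) :=
    fun E _ _ _ => Literature.NumberTheory.Transcendental.exists_deRhamIsoFamily_holds (E := E)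
  let μ : OrientationFamily := fun _ _ h ↦ Classical.choice (ComplexPoints.isOrientableOver ℂ h)
  haveI : Subsingleton (complexBetti S 1) := (hodd S hS).1
  -- a marking of `S`, Hodge models of `S` and `S ⊗ S`, multiplicativity of the Hodge types
  obtain ⟨η, p₀, x, hp₀, ⟨hp₀int, -, hηint, hηcup, -, -⟩, -⟩ := hmark S hS
  obtain ⟨A⟩ := hS.nonempty_hodgeModel
  obtain ⟨M, -⟩ := id hct
  have hP : IsSmoothProjective 4 (S ⊗ S) := IsSmoothProjective.tensor_holds hS.1 hS.1
  have hcupS : CupPreservesHodgeType 2 S :=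
    cupPreservesHodgeType_of_exists_deRhamIsoFamily hI hS.1 A (hdR A.model)
  have hcupP : CupPreservesHodgeType 4 (S ⊗ S) :=
    cupPreservesHodgeType_of_exists_deRhamIsoFamily hI hP M (hdR M.model)
  -- divisor classes are `(1,1)` (`N¹H² ⊆ H^{1,1}`) and conversely (Lefschetz `(1,1)`)
  have hN11 : ∀ d ∈ algebraicClasses S 1, IsOfHodgeType 2 S (2 * 1) 1 1 d := fun d hd =>
    NikulinTwinTransport.isOfHodgeType_oneOne_of_mem_algebraicClasses hG hS hd
  have hL11 : ∀ c : complexBetti S (2 * 1), IsRationalClass c → IsOfHodgeType 2 S (2 * 1) 1 1 c →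
      c ∈ algebraicClasses S 1 := fun c hc h11 => hL hS.1 c hc h11
  -- the `(2,2)`-heart of the bookkeeping at `e := 0`, `γ := 0`
  refine mem_algebraicClasses_of_typeTwoTwo μ hS η hp₀ hp₀int hηint hηcup
    (Hatcher2002_crossProducts_span_complexBetti_holds hS.1 hS.1) A M hcupS hcupP (hHI S) hN11 hL11 0
    (fun d _ => LinearMap.zero_apply d) (fun f h₁ h₂ h₃ h₄ => ?_)
    ⟨0, Submodule.zero_mem _, fun y => by rw [LinearMap.zero_apply, map_zero, map_zero]⟩ hc hct
  obtain ⟨a, ha⟩ := hU f h₁ h₂ h₃ h₄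
  exact ⟨a, 0, fun y hy => by rw [ha y hy, LinearMap.zero_apply, smul_zero, add_zero]⟩

end Summit.HodgeConjecture.HodgeConjecture.Theorems

end
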